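import Mathlib
import HarnessLib
import Summits.HubbardSuperconductivity.HubbardSuperconductivity.Theorems.KLProgrammeKLRegimeEngineLastStepResponseBracketMulti
import Summits.HubbardSuperconductivity.HubbardSuperconductivity.Theorems.KLProgrammeKLRegimeEngineLastStepResponseInputsGraded
import Summits.HubbardSuperconductivity.HubbardSuperconductivity.Theorems.KLProgrammePerturbedFermiCurveExplicit
import Summits.HubbardSuperconductivity.HubbardSuperconductivity.Theorems.KLProgrammePerturbedFermiCurveTowerOfSizes
import Summits.HubbardSuperconductivity.HubbardSuperconductivity.Theorems.KLProgrammePerturbedFermiCurveNumerics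
import Summits.HubbardSuperconductivity.HubbardSuperconductivity.Theorems.KLProgrammeH10TwoPointLimitFrameFermiPoint
import Summits.HubbardSuperconductivity.HubbardSuperconductivity.Theorems.KLProgrammeKLRegimeSplitSlotsV17F

/-!
# K3 gen-8-FLOW (stmt 20437, stub (C), located item #20, cure (δ′) «LAST-STEP SWAP», layer F3d): THE RESPONSE BRACKET AT THE FLOW FRAMES —
# `lastResponse_bracket_flow`: `(hRdiff, hR)` of `twoLegReadPriv_flow_succ_of_swap_lit` at `n = n_β` with the curve, the tangential parameter, the
# frequency window and the datum-`1` moments DISCHARGED from `FrameOK`, `FlowPieceJetsAt`, `klth` and `𝔉⁻¹[1]`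

Cell gate-hubbard-kl, seat p2 g17.  In the regime of `frame_sizes_of_frameOK_explicit` (`0 < c ≤ klCurveC3 R`, `0 < U ≤ klCurveU0 R`, `U ≤ 1`,
`klBetaMin ≤ β ≤ e^{c/U²}`, `μ ∈ klWindowC`) with the OLD flow frame admissible (`FrameOK R U n_β μ K_{n_β}`) and the last piece's jets
(`FlowPieceJetsAt … R n_β`), the inputs `hγ/hcurve/hDc` (curve `C⁴`, on the old Fermi curve, jets `klCurveD1, klCurveD2, klCurveD3 A₃, klCurveD4 A₃ A₄` —
`fermiPointLp_sizes_of_sizes`, `frameLevel_klFermiPoint`), `ht0/htd` (`lastResponse_tjets_of_pieceJets_graded` with `Gm = ΣGfr`, `D = 10¹⁴(1 + Gfr₃ + Gfr₄)`,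
`Zt ≥ 1920·Gm·D⁴`), `hω` (`Zω = 1/32`, `pi_div_le_Z_div_four_pow_nScales`) and `hMm_a/hMs_a` (`≡ 1`, `moments_datum_one`) of `lastResponse_bracket_multi` are
discharged; what remains are the supplier rows BY NAME: `IsUnit` of the two partition functions at `(K_N, N)`, `(K_{n_β}, N)`; the symbol sups `Dg_X, A₀_X`
(order `Mg ≥ 8`); the moments `Mm_b/Ms_b` of `σ_N[K_N]`, `Mm_c/Ms_c` of the odd average; the layer-A rows `AL_X`; the Bell rows `PP_X, AA_X` against the
EXPLICIT curve table; their sizes `PP_a ≤ Za·4^{jm}`, `PP_b ≤ Zb·U·4^{jm}`, `PP_c ≤ Zc·U²·4^{jm}/4^m`, `AA_X ≤ ZA_X·U³·4^{km}/16^m`; and the two smallness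
conditions `2·Zt·U ≤ 1`, `16·C·U ≤ 1`, `C = 2²⁹·(1/32)·Zt³·Za + 2³⁸·Zt²·Zb + 2³³·Zt·Zc + ΣZA`.

* §1 `flowCurve_table_graded` (the curve table is graded: `D1, D2 ≤ D`, `D3(A₃) ≤ D·4^m`, `D4(A₃,A₄) ≤ D·16^m`);
* §2 **`lastResponse_bracket_flow`**.

Composition only; no definitions; nothing asserts superconductivity.  Refs: BGM 2006 §2.2 (2.23), §2.4 Lemma 2.1 (2.36)–(2.42)
[cite: BenfattoGiulianiMastropietro2006]; FST 1996 §1 [cite: FeldmanSalmhoferTrubowitz1996].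
-/

noncomputable section

namespace Summit.HubbardSuperconductivity.HubbardSuperconductivity.Theorems.EngineV8

set_option linter.dupNamespace false -- summit = problem name (single-conjunct summit), D-0017

open Complex Real Finset Filter Literature.MathematicalPhysics.QuantumLattice Literature.Probability.LatticeModels
open Literature.MathematicalPhysics.QuantumLattice.BandSectorCounting
open Literature.Analysis.Fourier Literature.Analysis.Calculus
open Summit.HubbardSuperconductivity.HubbardSuperconductivity.Theorems.KLRegimeSplit
open Summit.HubbardSuperconductivity.HubbardSuperconductivity.Theorems.DispersionFlow
open Summit.HubbardSuperconductivity.HubbardSuperconductivity.Theorems.KLProgrammeLegKernels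
open Summit.HubbardSuperconductivity.HubbardSuperconductivity.Theorems.PerturbedFermiCurve

/-! ## §1 The flow frame's curve table is graded -/

/-- With `A₃ = Gfr₃U²4^{m+1}/3`, `A₄ = Gfr₄U²16^{m+1}/15`, `0 ≤ U ≤ 1`, `Gfr ≥ 0`, `D := 10¹⁴(1 + Gfr₃ + Gfr₄)`: `1 ≤ D`, `klCurveD1 ≤ D`, `klCurveD2 ≤ D`,
`klCurveD3 A₃ ≤ D·4^m`, `klCurveD4 A₃ A₄ ≤ D·(4^m)²`. -/
theorem flowCurve_table_graded {R : RenConsts} (hR : ∀ j, 0 ≤ R.Gfr j) {U : ℝ} (hU0 : 0 ≤ U) (hU1 : U ≤ 1) (m : ℕ) :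
    (1 : ℝ) ≤ (10 ^ 14 * (1 + R.Gfr 3 + R.Gfr 4)) ∧ klCurveD1 ≤ (10 ^ 14 * (1 + R.Gfr 3 + R.Gfr 4)) ∧ klCurveD2 ≤ (10 ^ 14 * (1 + R.Gfr 3 + R.Gfr 4)) ∧
    klCurveD3 (R.Gfr 3 * U ^ 2 * ((4 : ℝ) ^ (m + 1) / 3)) ≤ (10 ^ 14 * (1 + R.Gfr 3 + R.Gfr 4)) * (4 : ℝ) ^ m ∧
    klCurveD4 (R.Gfr 3 * U ^ 2 * ((4 : ℝ) ^ (m + 1) / 3)) (R.Gfr 4 * U ^ 2 * ((16 : ℝ) ^ (m + 1) / 15)) ≤ (10 ^ 14 * (1 + R.Gfr 3 + R.Gfr 4)) * ((4 : ℝ) ^ m) ^ 2 := by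
  have h3 := hR 3; have h4 := hR 4
  have hl : (1 : ℝ) ≤ (4 : ℝ) ^ m := one_le_pow₀ (by norm_num)
  have hU2 : U ^ 2 ≤ 1 := by nlinarith
  have hA₃0 : 0 ≤ R.Gfr 3 * U ^ 2 * ((4 : ℝ) ^ (m + 1) / 3) := by positivity
  have hA₄0 : 0 ≤ R.Gfr 4 * U ^ 2 * ((16 : ℝ) ^ (m + 1) / 15) := by positivity
  have hA₃ : R.Gfr 3 * U ^ 2 * ((4 : ℝ) ^ (m + 1) / 3) ≤ 2 * R.Gfr 3 * (4 : ℝ) ^ m := by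
    rw [show (4 : ℝ) ^ (m + 1) = (4 : ℝ) ^ m * 4 from pow_succ 4 m]
    have : R.Gfr 3 * U ^ 2 ≤ R.Gfr 3 := by nlinarith
    nlinarith [mul_le_mul_of_nonneg_right this (by positivity : (0 : ℝ) ≤ (4 : ℝ) ^ m)]
  have h16 : (16 : ℝ) ^ (m + 1) = 16 * ((4 : ℝ) ^ m) ^ 2 := by
    rw [show ((4 : ℝ) ^ m) ^ 2 = (16 : ℝ) ^ m by rw [← pow_mul, mul_comm, pow_mul]; norm_num, pow_succ, mul_comm]
  have hA₄ : R.Gfr 4 * U ^ 2 * ((16 : ℝ) ^ (m + 1) / 15) ≤ 2 * R.Gfr 4 * ((4 : ℝ) ^ m) ^ 2 := by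
    rw [h16]
    have : R.Gfr 4 * U ^ 2 ≤ R.Gfr 4 := by nlinarith
    nlinarith [mul_le_mul_of_nonneg_right this (by positivity : (0 : ℝ) ≤ ((4 : ℝ) ^ m) ^ 2)]
  have hD1 := klCurveD1_le; have hD2 := klCurveD2_le
  have hD3 := klCurveD3_le hA₃0; have hD4 := klCurveD4_le hA₃0 hA₄0
  have hl2 : (1 : ℝ) ≤ ((4 : ℝ) ^ m) ^ 2 := one_le_pow₀ hl
  refine ⟨by nlinarith, by nlinarith, by nlinarith, ?_, ?_⟩
  · calc klCurveD3 (R.Gfr 3 * U ^ 2 * ((4 : ℝ) ^ (m + 1) / 3)) ≤ 6500000000 + 160000000 * (2 * R.Gfr 3 * (4 : ℝ) ^ m) := by nlinarith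
      _ ≤ (10 ^ 14 * (1 + R.Gfr 3 + R.Gfr 4)) * (4 : ℝ) ^ m := by nlinarith [mul_nonneg h4 (le_trans zero_le_one hl), mul_nonneg h3 (le_trans zero_le_one hl)]
  · calc klCurveD4 (R.Gfr 3 * U ^ 2 * ((4 : ℝ) ^ (m + 1) / 3)) (R.Gfr 4 * U ^ 2 * ((16 : ℝ) ^ (m + 1) / 15))
        ≤ 99000000000000 + 4700000000000 * (2 * R.Gfr 3 * (4 : ℝ) ^ m) + 36000000000 * (2 * R.Gfr 4 * ((4 : ℝ) ^ m) ^ 2) := by nlinarith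
      _ ≤ (10 ^ 14 * (1 + R.Gfr 3 + R.Gfr 4)) * ((4 : ℝ) ^ m) ^ 2 := by
          have a : (4 : ℝ) ^ m ≤ ((4 : ℝ) ^ m) ^ 2 := by nlinarith
          nlinarith [mul_le_mul_of_nonneg_left a h3, mul_nonneg h3 (le_trans zero_le_one hl2), mul_nonneg h4 (le_trans zero_le_one hl2)]

/-! ## §2 The bracket at the flow frames -/

section Flow

variable {L M : ℕ} [NeZero L] [NeZero M]

/-- **THE RESPONSE BRACKET AT THE FLOW FRAMES** — see the module docstring.  Output = `(hRdiff, hR)` of `twoLegReadPriv_flow_succ_of_swap_lit` at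
`n = nScales β` with `eR = fun k => if k = 0 then 0 else 1`, `eR' = fun k => if k = 0 then 1 else 0`. -/
theorem lastResponse_bracket_flow {R : RenConsts} (hR : ∀ j, 0 ≤ R.Gfr j) {c : ℝ} (hc : 0 < c) (hcle : c ≤ klCurveC3 R)
    {U : ℝ} (hU : 0 < U) (hU1 : U ≤ 1) (hUle : U ≤ klCurveU0 R) {β : ℝ} (hβmin : klBetaMin ≤ β) (hβc : β ≤ Real.exp (c / U ^ 2))
    {μ : ℝ} (hμ : μ ∈ klWindowC) (hK : FrameOK R U (nScales β) μ (klFlowFrameU L M β U μ (nScales β))) (hP : FlowPieceJetsAt L M β U μ R (nScales β))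
    (hZn : IsUnit (effPartitionFn ℂ (normalCovariance L M (uvSymbolCT L M β μ (klFlowFrameU L M β U μ (nScales β + 1)) (klScale klE0 (nScales β + 1))))
      (hubbardInteraction L M β U + counterQuadratic L M β (klFlowFrameU L M β U μ (nScales β + 1)))))
    (hZo : IsUnit (effPartitionFn ℂ (normalCovariance L M (uvSymbolCT L M β μ (klFlowFrameU L M β U μ (nScales β)) (klScale klE0 (nScales β + 1))))
      (hubbardInteraction L M β U + counterQuadratic L M β (klFlowFrameU L M β U μ (nScales β)))))
    {Zt Za Zb Zc ZAa ZAb ZAc : ℝ} (hZt : 1920 * (R.Gfr 0 + R.Gfr 1 + R.Gfr 2 + R.Gfr 3 + R.Gfr 4) * (10 ^ 14 * (1 + R.Gfr 3 + R.Gfr 4)) ^ 4 ≤ Zt) (hZtU : 2 * Zt * U ≤ 1)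
    (hCU : 16 * (2 ^ 29 * (1 / 32) * Zt ^ 3 * Za + 2 ^ 38 * Zt ^ 2 * Zb + 2 ^ 33 * Zt * Zc + (ZAa + ZAb + ZAc)) * U ≤ 1)
    {Mg : ℕ} (hMg : 8 ≤ Mg) {s : ℕ}
    {Dga : ℝ} (hDga : ∀ q, ‖iteratedFDeriv ℝ Mg (fun q : Momentum => ((((evalM (fsub (klFlowFrameU L M β U μ (nScales β)) (klFlowFrameU L M β U μ (nScales β + 1))) q * evalM (fsub
        (klFlowFrameU L M β U μ (nScales β)) (klFlowFrameU L M β U μ (nScales β + 1))) q) / (β * (L : ℝ) ^ 2) : ℝ)) : ℂ) * (((uvWeightFn (klScale klE0 (nScales β + 1)) (matsubaraFreq β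
        M (omega0 M)) (frameLevel μ (klFlowFrameU L M β U μ (nScales β)) q) : ℝ) : ℂ) * resolventFnXi (β * (L : ℝ) ^ 2) 0 (matsubaraFreq β M (omega0 M)) (frameLevel μ (klFlowFrameU L M
        β U μ (nScales β)) q + uvWeightFn (klScale klE0 (nScales β + 1)) (matsubaraFreq β M (omega0 M)) (frameLevel μ (klFlowFrameU L M β U μ (nScales β)) q) * evalM (fsub
        (klFlowFrameU L M β U μ (nScales β)) (klFlowFrameU L M β U μ (nScales β + 1))) q))) q‖ ≤ Dga) {A₀a : ℝ} (hA₀a : ∀ q, ‖(fun q : Momentum => ((((evalM (fsub (klFlowFrameU L M β U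
        μ (nScales β)) (klFlowFrameU L M β U μ (nScales β + 1))) q * evalM (fsub (klFlowFrameU L M β U μ (nScales β)) (klFlowFrameU L M β U μ (nScales β + 1))) q) / (β * (L : ℝ) ^ 2) :
        ℝ)) : ℂ) * (((uvWeightFn (klScale klE0 (nScales β + 1)) (matsubaraFreq β M (omega0 M)) (frameLevel μ (klFlowFrameU L M β U μ (nScales β)) q) : ℝ) : ℂ) * resolventFnXi (β * (L :
        ℝ) ^ 2) 0 (matsubaraFreq β M (omega0 M)) (frameLevel μ (klFlowFrameU L M β U μ (nScales β)) q + uvWeightFn (klScale klE0 (nScales β + 1)) (matsubaraFreq β M (omega0 M))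
        (frameLevel μ (klFlowFrameU L M β U μ (nScales β)) q) * evalM (fsub (klFlowFrameU L M β U μ (nScales β)) (klFlowFrameU L M β U μ (nScales β + 1))) q))) q‖ ≤ A₀a)
    {Dgb : ℝ} (hDgb : ∀ q, ‖iteratedFDeriv ℝ Mg (fun q : Momentum => ((((evalM (fsub (klFlowFrameU L M β U μ (nScales β)) (klFlowFrameU L M β U μ (nScales β + 1))) q / (β * (L : ℝ) ^
        2) : ℝ)) : ℂ) * (((uvWeightFn (klScale klE0 (nScales β + 1)) (matsubaraFreq β M (omega0 M)) (frameLevel μ (klFlowFrameU L M β U μ (nScales β)) q) : ℝ) : ℂ) * resolventFnXi (β *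
        (L : ℝ) ^ 2) 0 (matsubaraFreq β M (omega0 M)) (frameLevel μ (klFlowFrameU L M β U μ (nScales β)) q + uvWeightFn (klScale klE0 (nScales β + 1)) (matsubaraFreq β M (omega0 M))
        (frameLevel μ (klFlowFrameU L M β U μ (nScales β)) q) * evalM (fsub (klFlowFrameU L M β U μ (nScales β)) (klFlowFrameU L M β U μ (nScales β + 1))) q))) * ((((evalM (fsub
        (klFlowFrameU L M β U μ (nScales β)) (klFlowFrameU L M β U μ (nScales β + 1))) q / (β * (L : ℝ) ^ 2) : ℝ)) : ℂ) * (((uvWeightFn (klScale klE0 (nScales β + 1)) (matsubaraFreq β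
        M (omega0 M)) (frameLevel μ (klFlowFrameU L M β U μ (nScales β)) q) : ℝ) : ℂ) * resolventFnXi (β * (L : ℝ) ^ 2) 0 (matsubaraFreq β M (omega0 M)) (frameLevel μ (klFlowFrameU L M
        β U μ (nScales β)) q + uvWeightFn (klScale klE0 (nScales β + 1)) (matsubaraFreq β M (omega0 M)) (frameLevel μ (klFlowFrameU L M β U μ (nScales β)) q) * evalM (fsub
        (klFlowFrameU L M β U μ (nScales β)) (klFlowFrameU L M β U μ (nScales β + 1))) q))) - (2 : ℂ) * ((((evalM (fsub (klFlowFrameU L M β U μ (nScales β)) (klFlowFrameU L M β U μ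
        (nScales β + 1))) q / (β * (L : ℝ) ^ 2) : ℝ)) : ℂ) * (((uvWeightFn (klScale klE0 (nScales β + 1)) (matsubaraFreq β M (omega0 M)) (frameLevel μ (klFlowFrameU L M β U μ (nScales
        β)) q) : ℝ) : ℂ) * resolventFnXi (β * (L : ℝ) ^ 2) 0 (matsubaraFreq β M (omega0 M)) (frameLevel μ (klFlowFrameU L M β U μ (nScales β)) q + uvWeightFn (klScale klE0 (nScales β +
        1)) (matsubaraFreq β M (omega0 M)) (frameLevel μ (klFlowFrameU L M β U μ (nScales β)) q) * evalM (fsub (klFlowFrameU L M β U μ (nScales β)) (klFlowFrameU L M β U μ (nScales β +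
        1))) q)))) q‖ ≤ Dgb) {A₀b : ℝ} (hA₀b : ∀ q, ‖(fun q : Momentum => ((((evalM (fsub (klFlowFrameU L M β U μ (nScales β)) (klFlowFrameU L M β U μ (nScales β + 1))) q / (β * (L :
        ℝ) ^ 2) : ℝ)) : ℂ) * (((uvWeightFn (klScale klE0 (nScales β + 1)) (matsubaraFreq β M (omega0 M)) (frameLevel μ (klFlowFrameU L M β U μ (nScales β)) q) : ℝ) : ℂ) * resolventFnXi
        (β * (L : ℝ) ^ 2) 0 (matsubaraFreq β M (omega0 M)) (frameLevel μ (klFlowFrameU L M β U μ (nScales β)) q + uvWeightFn (klScale klE0 (nScales β + 1)) (matsubaraFreq β M (omega0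
        M)) (frameLevel μ (klFlowFrameU L M β U μ (nScales β)) q) * evalM (fsub (klFlowFrameU L M β U μ (nScales β)) (klFlowFrameU L M β U μ (nScales β + 1))) q))) * ((((evalM (fsub
        (klFlowFrameU L M β U μ (nScales β)) (klFlowFrameU L M β U μ (nScales β + 1))) q / (β * (L : ℝ) ^ 2) : ℝ)) : ℂ) * (((uvWeightFn (klScale klE0 (nScales β + 1)) (matsubaraFreq β
        M (omega0 M)) (frameLevel μ (klFlowFrameU L M β U μ (nScales β)) q) : ℝ) : ℂ) * resolventFnXi (β * (L : ℝ) ^ 2) 0 (matsubaraFreq β M (omega0 M)) (frameLevel μ (klFlowFrameU L M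
        β U μ (nScales β)) q + uvWeightFn (klScale klE0 (nScales β + 1)) (matsubaraFreq β M (omega0 M)) (frameLevel μ (klFlowFrameU L M β U μ (nScales β)) q) * evalM (fsub
        (klFlowFrameU L M β U μ (nScales β)) (klFlowFrameU L M β U μ (nScales β + 1))) q))) - (2 : ℂ) * ((((evalM (fsub (klFlowFrameU L M β U μ (nScales β)) (klFlowFrameU L M β U μ
        (nScales β + 1))) q / (β * (L : ℝ) ^ 2) : ℝ)) : ℂ) * (((uvWeightFn (klScale klE0 (nScales β + 1)) (matsubaraFreq β M (omega0 M)) (frameLevel μ (klFlowFrameU L M β U μ (nScales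
        β)) q) : ℝ) : ℂ) * resolventFnXi (β * (L : ℝ) ^ 2) 0 (matsubaraFreq β M (omega0 M)) (frameLevel μ (klFlowFrameU L M β U μ (nScales β)) q + uvWeightFn (klScale klE0 (nScales β +
        1)) (matsubaraFreq β M (omega0 M)) (frameLevel μ (klFlowFrameU L M β U μ (nScales β)) q) * evalM (fsub (klFlowFrameU L M β U μ (nScales β)) (klFlowFrameU L M β U μ (nScales β +
        1))) q)))) q‖ ≤ A₀b)
    {Mmb : ℕ → ℝ} (hMmb : ∀ m ≤ 4, ∑ x : TorusSite 2 L, (1 + ((x 0).valMinAbs.natAbs : ℝ) + ((x 1).valMinAbs.natAbs : ℝ)) ^ m *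
      ‖torusFourierInv (fun k => ((((fun k : TorusSite 2 L => klLocSelfEnergyRe L M β U μ (klFlowFrameU L M β U μ (nScales β + 1)) (nScales β + 1) k) k : ℝ)) : ℂ)) x‖ ≤ Mmb m)
    {Msb : ℝ} (hMsb : ∑ x : TorusSite 2 L, (1 + ((x 0).valMinAbs.natAbs : ℝ) + ((x 1).valMinAbs.natAbs : ℝ)) ^ s *
      ‖torusFourierInv (fun k => ((((fun k : TorusSite 2 L => klLocSelfEnergyRe L M β U μ (klFlowFrameU L M β U μ (nScales β + 1)) (nScales β + 1) k) k : ℝ)) : ℂ)) x‖ ≤ Msb)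
    {Dgc : ℝ} (hDgc : ∀ q, ‖iteratedFDeriv ℝ Mg (fun q : Momentum => -I * (((((evalM (fsub (klFlowFrameU L M β U μ (nScales β)) (klFlowFrameU L M β U μ (nScales β + 1))) q / (β * (L :
        ℝ) ^ 2) : ℝ)) : ℂ) * (((uvWeightFn (klScale klE0 (nScales β + 1)) (matsubaraFreq β M (omega0 M)) (frameLevel μ (klFlowFrameU L M β U μ (nScales β)) q) : ℝ) : ℂ) * resolventFnXi
        (β * (L : ℝ) ^ 2) 0 (matsubaraFreq β M (omega0 M)) (frameLevel μ (klFlowFrameU L M β U μ (nScales β)) q + uvWeightFn (klScale klE0 (nScales β + 1)) (matsubaraFreq β M (omega0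
        M)) (frameLevel μ (klFlowFrameU L M β U μ (nScales β)) q) * evalM (fsub (klFlowFrameU L M β U μ (nScales β)) (klFlowFrameU L M β U μ (nScales β + 1))) q))) * ((((evalM (fsub
        (klFlowFrameU L M β U μ (nScales β)) (klFlowFrameU L M β U μ (nScales β + 1))) q / (β * (L : ℝ) ^ 2) : ℝ)) : ℂ) * (((uvWeightFn (klScale klE0 (nScales β + 1)) (matsubaraFreq β
        M (omega0 M)) (frameLevel μ (klFlowFrameU L M β U μ (nScales β)) q) : ℝ) : ℂ) * resolventFnXi (β * (L : ℝ) ^ 2) 0 (matsubaraFreq β M (omega0 M)) (frameLevel μ (klFlowFrameU L M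
        β U μ (nScales β)) q + uvWeightFn (klScale klE0 (nScales β + 1)) (matsubaraFreq β M (omega0 M)) (frameLevel μ (klFlowFrameU L M β U μ (nScales β)) q) * evalM (fsub
        (klFlowFrameU L M β U μ (nScales β)) (klFlowFrameU L M β U μ (nScales β + 1))) q))) - (2 : ℂ) * ((((evalM (fsub (klFlowFrameU L M β U μ (nScales β)) (klFlowFrameU L M β U μ
        (nScales β + 1))) q / (β * (L : ℝ) ^ 2) : ℝ)) : ℂ) * (((uvWeightFn (klScale klE0 (nScales β + 1)) (matsubaraFreq β M (omega0 M)) (frameLevel μ (klFlowFrameU L M β U μ (nScales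
        β)) q) : ℝ) : ℂ) * resolventFnXi (β * (L : ℝ) ^ 2) 0 (matsubaraFreq β M (omega0 M)) (frameLevel μ (klFlowFrameU L M β U μ (nScales β)) q + uvWeightFn (klScale klE0 (nScales β +
        1)) (matsubaraFreq β M (omega0 M)) (frameLevel μ (klFlowFrameU L M β U μ (nScales β)) q) * evalM (fsub (klFlowFrameU L M β U μ (nScales β)) (klFlowFrameU L M β U μ (nScales β +
        1))) q))))) q‖ ≤ Dgc) {A₀c : ℝ} (hA₀c : ∀ q, ‖(fun q : Momentum => -I * (((((evalM (fsub (klFlowFrameU L M β U μ (nScales β)) (klFlowFrameU L M β U μ (nScales β + 1))) q / (β *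
        (L : ℝ) ^ 2) : ℝ)) : ℂ) * (((uvWeightFn (klScale klE0 (nScales β + 1)) (matsubaraFreq β M (omega0 M)) (frameLevel μ (klFlowFrameU L M β U μ (nScales β)) q) : ℝ) : ℂ) *
        resolventFnXi (β * (L : ℝ) ^ 2) 0 (matsubaraFreq β M (omega0 M)) (frameLevel μ (klFlowFrameU L M β U μ (nScales β)) q + uvWeightFn (klScale klE0 (nScales β + 1)) (matsubaraFreq
        β M (omega0 M)) (frameLevel μ (klFlowFrameU L M β U μ (nScales β)) q) * evalM (fsub (klFlowFrameU L M β U μ (nScales β)) (klFlowFrameU L M β U μ (nScales β + 1))) q))) *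
        ((((evalM (fsub (klFlowFrameU L M β U μ (nScales β)) (klFlowFrameU L M β U μ (nScales β + 1))) q / (β * (L : ℝ) ^ 2) : ℝ)) : ℂ) * (((uvWeightFn (klScale klE0 (nScales β + 1))
        (matsubaraFreq β M (omega0 M)) (frameLevel μ (klFlowFrameU L M β U μ (nScales β)) q) : ℝ) : ℂ) * resolventFnXi (β * (L : ℝ) ^ 2) 0 (matsubaraFreq β M (omega0 M)) (frameLevel μ
        (klFlowFrameU L M β U μ (nScales β)) q + uvWeightFn (klScale klE0 (nScales β + 1)) (matsubaraFreq β M (omega0 M)) (frameLevel μ (klFlowFrameU L M β U μ (nScales β)) q) * evalM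
        (fsub (klFlowFrameU L M β U μ (nScales β)) (klFlowFrameU L M β U μ (nScales β + 1))) q))) - (2 : ℂ) * ((((evalM (fsub (klFlowFrameU L M β U μ (nScales β)) (klFlowFrameU L M β U
        μ (nScales β + 1))) q / (β * (L : ℝ) ^ 2) : ℝ)) : ℂ) * (((uvWeightFn (klScale klE0 (nScales β + 1)) (matsubaraFreq β M (omega0 M)) (frameLevel μ (klFlowFrameU L M β U μ
        (nScales β)) q) : ℝ) : ℂ) * resolventFnXi (β * (L : ℝ) ^ 2) 0 (matsubaraFreq β M (omega0 M)) (frameLevel μ (klFlowFrameU L M β U μ (nScales β)) q + uvWeightFn (klScale klE0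
        (nScales β + 1)) (matsubaraFreq β M (omega0 M)) (frameLevel μ (klFlowFrameU L M β U μ (nScales β)) q) * evalM (fsub (klFlowFrameU L M β U μ (nScales β)) (klFlowFrameU L M β U μ
        (nScales β + 1))) q))))) q‖ ≤ A₀c)
    {Mmc : ℕ → ℝ} (hMmc : ∀ m ≤ 4, ∑ x : TorusSite 2 L, (1 + ((x 0).valMinAbs.natAbs : ℝ) + ((x 1).valMinAbs.natAbs : ℝ)) ^ m *
      ‖torusFourierInv (fun k => ((((fun k : TorusSite 2 L => (∑ s : Fin 2, ((klSelfEnergy L M β U μ (klFlowFrameU L M β U μ (nScales β + 1)) klE0 (nScales β + 1) (omega0 M, k) s).im -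
          (klSelfEnergy L M β U μ (klFlowFrameU L M β U μ (nScales β + 1)) klE0 (nScales β + 1) ((omega0 M).rev, k) s).im)) / 4) k : ℝ)) : ℂ)) x‖ ≤ Mmc m)
    {Msc : ℝ} (hMsc : ∑ x : TorusSite 2 L, (1 + ((x 0).valMinAbs.natAbs : ℝ) + ((x 1).valMinAbs.natAbs : ℝ)) ^ s *
      ‖torusFourierInv (fun k => ((((fun k : TorusSite 2 L => (∑ s : Fin 2, ((klSelfEnergy L M β U μ (klFlowFrameU L M β U μ (nScales β + 1)) klE0 (nScales β + 1) (omega0 M, k) s).im -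
          (klSelfEnergy L M β U μ (klFlowFrameU L M β U μ (nScales β + 1)) klE0 (nScales β + 1) ((omega0 M).rev, k) s).im)) / 4) k : ℝ)) : ℂ)) x‖ ≤ Msc)
    {ALa : ℕ → ℝ}
    (hALa : ∀ j ≤ 4, 2 * (2 * (1 * ((3 : ℝ) ^ j * Dga * (2 / ((2 * (L / 4 + 1) : ℕ) : ℝ)) ^ (Mg - j - 4) *
        (2 ^ 2 * ∑' k : Fin 2 → ℤ, ∏ i, (1 + (k i : ℝ) ^ 2)⁻¹)))) + (L : ℝ) ^ 2 * (L : ℝ) ^ j * (A₀a * (1 / (1 + (L : ℝ) / 4) ^ s)) ≤ ALa j)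
    {PPa : ℕ → ℝ} (hPPa0 : 1 ≤ PPa 0) (hPPa1 : 1 * klCurveD1 ≤ PPa 1) (hPPa2 : 1 * klCurveD1 ^ 2 + 1 * klCurveD2 ≤ PPa 2)
    (hPPa3 : 1 * klCurveD1 ^ 3 + 3 * 1 * klCurveD1 * klCurveD2 + 1 * (klCurveD3 (R.Gfr 3 * U ^ 2 * ((4 : ℝ) ^ (nScales β + 1) / 3))) ≤ PPa 3)
    (hPPa4 : 1 * klCurveD1 ^ 4 + 6 * 1 * klCurveD1 ^ 2 * klCurveD2 + 3 * 1 * klCurveD2 ^ 2 + 4 * 1 * klCurveD1 * (klCurveD3 (R.Gfr 3 * U ^ 2 * ((4 : ℝ) ^ (nScales β + 1) / 3))) + 1 *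
        (klCurveD4 (R.Gfr 3 * U ^ 2 * ((4 : ℝ) ^ (nScales β + 1) / 3)) (R.Gfr 4 * U ^ 2 * ((16 : ℝ) ^ (nScales β + 1) / 15))) ≤ PPa 4)
    {AAa : ℕ → ℝ} (hAAa0 : ALa 0 ≤ AAa 0) (hAAa1 : ALa 1 * klCurveD1 ≤ AAa 1) (hAAa2 : ALa 2 * klCurveD1 ^ 2 + ALa 1 * klCurveD2 ≤ AAa 2)
    (hAAa3 : ALa 3 * klCurveD1 ^ 3 + 3 * ALa 2 * klCurveD1 * klCurveD2 + ALa 1 * (klCurveD3 (R.Gfr 3 * U ^ 2 * ((4 : ℝ) ^ (nScales β + 1) / 3))) ≤ AAa 3)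
    (hAAa4 : ALa 4 * klCurveD1 ^ 4 + 6 * ALa 3 * klCurveD1 ^ 2 * klCurveD2 + 3 * ALa 2 * klCurveD2 ^ 2 + 4 * ALa 2 * klCurveD1 * (klCurveD3 (R.Gfr 3 * U ^ 2 * ((4 : ℝ) ^ (nScales β +
        1) / 3))) + ALa 1 * (klCurveD4 (R.Gfr 3 * U ^ 2 * ((4 : ℝ) ^ (nScales β + 1) / 3)) (R.Gfr 4 * U ^ 2 * ((16 : ℝ) ^ (nScales β + 1) / 15))) ≤ AAa 4)
    {ALb : ℕ → ℝ}
    (hALb : ∀ j ≤ 4, 2 * (2 * (Mmb j * ((3 : ℝ) ^ j * Dgb * (2 / ((2 * (L / 4 + 1) : ℕ) : ℝ)) ^ (Mg - j - 4) *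
        (2 ^ 2 * ∑' k : Fin 2 → ℤ, ∏ i, (1 + (k i : ℝ) ^ 2)⁻¹)))) + (L : ℝ) ^ 2 * (L : ℝ) ^ j * (A₀b * (Msb / (1 + (L : ℝ) / 4) ^ s)) ≤ ALb j)
    {PPb : ℕ → ℝ} (hPPb0 : Mmb 0 ≤ PPb 0) (hPPb1 : Mmb 1 * klCurveD1 ≤ PPb 1) (hPPb2 : Mmb 2 * klCurveD1 ^ 2 + Mmb 1 * klCurveD2 ≤ PPb 2)
    (hPPb3 : Mmb 3 * klCurveD1 ^ 3 + 3 * Mmb 2 * klCurveD1 * klCurveD2 + Mmb 1 * (klCurveD3 (R.Gfr 3 * U ^ 2 * ((4 : ℝ) ^ (nScales β + 1) / 3))) ≤ PPb 3)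
    (hPPb4 : Mmb 4 * klCurveD1 ^ 4 + 6 * Mmb 3 * klCurveD1 ^ 2 * klCurveD2 + 3 * Mmb 2 * klCurveD2 ^ 2 + 4 * Mmb 2 * klCurveD1 * (klCurveD3 (R.Gfr 3 * U ^ 2 * ((4 : ℝ) ^ (nScales β +
        1) / 3))) + Mmb 1 * (klCurveD4 (R.Gfr 3 * U ^ 2 * ((4 : ℝ) ^ (nScales β + 1) / 3)) (R.Gfr 4 * U ^ 2 * ((16 : ℝ) ^ (nScales β + 1) / 15))) ≤ PPb 4)
    {AAb : ℕ → ℝ} (hAAb0 : ALb 0 ≤ AAb 0) (hAAb1 : ALb 1 * klCurveD1 ≤ AAb 1) (hAAb2 : ALb 2 * klCurveD1 ^ 2 + ALb 1 * klCurveD2 ≤ AAb 2)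
    (hAAb3 : ALb 3 * klCurveD1 ^ 3 + 3 * ALb 2 * klCurveD1 * klCurveD2 + ALb 1 * (klCurveD3 (R.Gfr 3 * U ^ 2 * ((4 : ℝ) ^ (nScales β + 1) / 3))) ≤ AAb 3)
    (hAAb4 : ALb 4 * klCurveD1 ^ 4 + 6 * ALb 3 * klCurveD1 ^ 2 * klCurveD2 + 3 * ALb 2 * klCurveD2 ^ 2 + 4 * ALb 2 * klCurveD1 * (klCurveD3 (R.Gfr 3 * U ^ 2 * ((4 : ℝ) ^ (nScales β +
        1) / 3))) + ALb 1 * (klCurveD4 (R.Gfr 3 * U ^ 2 * ((4 : ℝ) ^ (nScales β + 1) / 3)) (R.Gfr 4 * U ^ 2 * ((16 : ℝ) ^ (nScales β + 1) / 15))) ≤ AAb 4)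
    {ALc : ℕ → ℝ}
    (hALc : ∀ j ≤ 4, 2 * (2 * (Mmc j * ((3 : ℝ) ^ j * Dgc * (2 / ((2 * (L / 4 + 1) : ℕ) : ℝ)) ^ (Mg - j - 4) *
        (2 ^ 2 * ∑' k : Fin 2 → ℤ, ∏ i, (1 + (k i : ℝ) ^ 2)⁻¹)))) + (L : ℝ) ^ 2 * (L : ℝ) ^ j * (A₀c * (Msc / (1 + (L : ℝ) / 4) ^ s)) ≤ ALc j)
    {PPc : ℕ → ℝ} (hPPc0 : Mmc 0 ≤ PPc 0) (hPPc1 : Mmc 1 * klCurveD1 ≤ PPc 1) (hPPc2 : Mmc 2 * klCurveD1 ^ 2 + Mmc 1 * klCurveD2 ≤ PPc 2)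
    (hPPc3 : Mmc 3 * klCurveD1 ^ 3 + 3 * Mmc 2 * klCurveD1 * klCurveD2 + Mmc 1 * (klCurveD3 (R.Gfr 3 * U ^ 2 * ((4 : ℝ) ^ (nScales β + 1) / 3))) ≤ PPc 3)
    (hPPc4 : Mmc 4 * klCurveD1 ^ 4 + 6 * Mmc 3 * klCurveD1 ^ 2 * klCurveD2 + 3 * Mmc 2 * klCurveD2 ^ 2 + 4 * Mmc 2 * klCurveD1 * (klCurveD3 (R.Gfr 3 * U ^ 2 * ((4 : ℝ) ^ (nScales β +
        1) / 3))) + Mmc 1 * (klCurveD4 (R.Gfr 3 * U ^ 2 * ((4 : ℝ) ^ (nScales β + 1) / 3)) (R.Gfr 4 * U ^ 2 * ((16 : ℝ) ^ (nScales β + 1) / 15))) ≤ PPc 4)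
    {AAc : ℕ → ℝ} (hAAc0 : ALc 0 ≤ AAc 0) (hAAc1 : ALc 1 * klCurveD1 ≤ AAc 1) (hAAc2 : ALc 2 * klCurveD1 ^ 2 + ALc 1 * klCurveD2 ≤ AAc 2)
    (hAAc3 : ALc 3 * klCurveD1 ^ 3 + 3 * ALc 2 * klCurveD1 * klCurveD2 + ALc 1 * (klCurveD3 (R.Gfr 3 * U ^ 2 * ((4 : ℝ) ^ (nScales β + 1) / 3))) ≤ AAc 3)
    (hAAc4 : ALc 4 * klCurveD1 ^ 4 + 6 * ALc 3 * klCurveD1 ^ 2 * klCurveD2 + 3 * ALc 2 * klCurveD2 ^ 2 + 4 * ALc 2 * klCurveD1 * (klCurveD3 (R.Gfr 3 * U ^ 2 * ((4 : ℝ) ^ (nScales β +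
        1) / 3))) + ALc 1 * (klCurveD4 (R.Gfr 3 * U ^ 2 * ((4 : ℝ) ^ (nScales β + 1) / 3)) (R.Gfr 4 * U ^ 2 * ((16 : ℝ) ^ (nScales β + 1) / 15))) ≤ AAc 4)
    (hPPas : ∀ j ≤ 4, PPa j ≤ Za * ((4 : ℝ) ^ nScales β) ^ j) (hPPbs : ∀ j ≤ 4, PPb j ≤ Zb * U * ((4 : ℝ) ^ nScales β) ^ j)
    (hPPcs : ∀ j ≤ 4, PPc j ≤ Zc * U ^ 2 * ((4 : ℝ) ^ nScales β) ^ j / ((4 : ℝ) ^ nScales β))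
    (hAAas : ∀ k ≤ 4, AAa k ≤ ZAa * U ^ 3 * ((4 : ℝ) ^ nScales β) ^ k / ((4 : ℝ) ^ nScales β) ^ 2) (hAAbs : ∀ k ≤ 4, AAb k ≤ ZAb * U ^ 3 * ((4 : ℝ) ^ nScales β) ^ k / ((4 : ℝ) ^ nScales β) ^ 2)
    (hAAcs : ∀ k ≤ 4, AAc k ≤ ZAc * U ^ 3 * ((4 : ℝ) ^ nScales β) ^ k / ((4 : ℝ) ^ nScales β) ^ 2) :
    ContDiff ℝ 4 (fun θ : ℝ => (symInterp L (fun k => klLocSelfEnergyRe L M β U μ (klFlowFrameU L M β U μ (nScales β + 1)) (nScales β + 1) k -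
            (klFlowFrameU L M β U μ (nScales β + 1)).eval (latticeMomentum L k))).eval (klFermiPoint μ (klFlowFrameU L M β U μ (nScales β)) θ) -
        (symInterp L (fun k => klLocSelfEnergyRe L M β U μ (klFlowFrameU L M β U μ (nScales β)) (nScales β + 1) k -
            (klFlowFrameU L M β U μ (nScales β)).eval (latticeMomentum L k))).eval (klFermiPoint μ (klFlowFrameU L M β U μ (nScales β)) θ)) ∧
    ∀ k ≤ 4, ∀ θ : ℝ, |iteratedDeriv k (fun θ : ℝ => (symInterp L (fun k => klLocSelfEnergyRe L M β U μ (klFlowFrameU L M β U μ (nScales β + 1)) (nScales β + 1) k -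
            (klFlowFrameU L M β U μ (nScales β + 1)).eval (latticeMomentum L k))).eval (klFermiPoint μ (klFlowFrameU L M β U μ (nScales β)) θ) -
        (symInterp L (fun k => klLocSelfEnergyRe L M β U μ (klFlowFrameU L M β U μ (nScales β)) (nScales β + 1) k -
            (klFlowFrameU L M β U μ (nScales β)).eval (latticeMomentum L k))).eval (klFermiPoint μ (klFlowFrameU L M β U μ (nScales β)) θ)) θ| ≤
      curveJetBar (fun k => if k = 0 then 0 else 1) (fun k => if k = 0 then 1 else 0) U k (nScales β + 1) := by
  have hβ0 : 0 < β := KLRegimeSplit.pos_of_klBetaMin_le hβmin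
  -- the curve of the old flow frame
  obtain ⟨hAf, hA20, -, hd, ⟨hlo, hhi⟩, hA₃, hA₄⟩ := frame_sizes_of_frameOK_explicit hR hc hcle hU hUle hβmin hβc hμ hK
  have hcv := fun θ : ℝ => fermiPointLp_sizes_of_sizes hAf hA20 hd hlo hhi hA₃ hA₄ θ
  have hγ : ContDiff ℝ 4 (fun θ : ℝ => (WithLp.toLp 2 (klFermiPoint μ (klFlowFrameU L M β U μ (nScales β)) θ) : Momentum)) := (hcv 0).1
  have hDc : ∀ θ : ℝ, ∀ i, 1 ≤ i → i ≤ 4 → ‖iteratedDeriv i (fun θ : ℝ => (WithLp.toLp 2 (klFermiPoint μ (klFlowFrameU L M β U μ (nScales β)) θ) : Momentum)) θ‖ ≤ (fun i : ℕ => if i =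
      1 then klCurveD1 else if i = 2 then klCurveD2 else if i = 3 then klCurveD3 (R.Gfr 3 * U ^ 2 * ((4 : ℝ) ^ (nScales β + 1) / 3)) else klCurveD4 (R.Gfr 3 * U ^ 2 * ((4 : ℝ) ^
      (nScales β + 1) / 3)) (R.Gfr 4 * U ^ 2 * ((16 : ℝ) ^ (nScales β + 1) / 15))) i := by
    intro θ i hi1 hi4
    obtain ⟨-, g1, g2, g3, g4⟩ := hcv θ
    rw [← norm_iteratedFDeriv_eq_norm_iteratedDeriv]
    interval_cases i
    · exact g1
    · exact g2
    · exact g3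
    · exact g4
  have hcurve : ∀ θ : ℝ, frameLevel μ (klFlowFrameU L M β U μ (nScales β)) ((fun θ : ℝ => (WithLp.toLp 2 (klFermiPoint μ (klFlowFrameU L M β U μ (nScales β)) θ) : Momentum)) θ) = 0 := fun θ =>
    frameLevel_klFermiPoint (bandBounds (show (-4 : ℝ) < -1.1 by norm_num) (show (-1.1 : ℝ) ≤ -0.1 by norm_num) (show (-0.1 : ℝ) < 0 by norm_num))
      hAf hlo hhi θ
  -- the graded table and the tangential jets of the last piece
  obtain ⟨hD1, hDc1, hDc2, hDc3, hDc4⟩ := flowCurve_table_graded hR hU.le hU1 (nScales β)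
  have hG5 : ∀ j ≤ 4, R.Gfr j ≤ (R.Gfr 0 + R.Gfr 1 + R.Gfr 2 + R.Gfr 3 + R.Gfr 4) := by
    intro j hj
    have := hR 0; have := hR 1; have := hR 2; have := hR 3; have := hR 4
    interval_cases j <;> linarith
  obtain ⟨ht0, htd⟩ := lastResponse_tjets_of_pieceJets_graded hβ0 (Nat.lt_succ_self _) hU hU1 (klFlowFrameU L M β U μ (nScales β)) (klFlowPiece L M β U μ (nScales β))
    (fun j hj => hR j) hG5 hP hγ hDc hD1 hDc1 hDc2 hDc3 hDc4 hZt
  rw [← klFlowFrameU_succ] at ht0 htd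
  have hZt0 : 0 ≤ Zt := le_trans (by have := hR 0; have := hR 1; have := hR 2; have := hR 3; have := hR 4; positivity) hZt
  -- the frequency window and the datum `1`
  have hω := pi_div_le_Z_div_four_pow_nScales hβmin (le_refl (1 / 32 : ℝ))
  -- the bracket
  exact lastResponse_bracket_multi (L := L) (M := M) hβ0 hU μ (klFlowFrameU L M β U μ (nScales β)) (klFlowFrameU L M β U μ (nScales β + 1)) (Nat.lt_succ_self
      _) hZn hZo hγ hcurve hDc (nScales β) hZt0 hZtU hCU hω
    ht0 htd hMg hDga hA₀a (fun m _ => (moments_datum_one (L := L) m).le) (moments_datum_one (L := L) s).le hDgb hA₀b hMmb hMsb hDgc hA₀c hMmc hMsc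
    hALa hPPa0 hPPa1 hPPa2 hPPa3 hPPa4 hAAa0 hAAa1 hAAa2 hAAa3 hAAa4
    hALb hPPb0 hPPb1 hPPb2 hPPb3 hPPb4 hAAb0 hAAb1 hAAb2 hAAb3 hAAb4
    hALc hPPc0 hPPc1 hPPc2 hPPc3 hPPc4 hAAc0 hAAc1 hAAc2 hAAc3 hAAc4 hPPas hPPbs hPPcs hAAas hAAbs hAAcs

end Flow

end Summit.HubbardSuperconductivity.HubbardSuperconductivity.Theorems.EngineV8

end
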